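import Mathlib

/-!
# Route C, R5 step 13.2(a): the isotypic part of `H¹(S)` is `H¹(B) ⊗_T M(S)`, and every Hodge
morphism is `T`-linear on it — the linear algebra, on the kernel (seat t3-p3)

Blind re-derivation cell `pub-hodge-repro`, Tier-3 seat `t3-p3`.  ROUTE-C §13.2(a) (the first of the
paper residues of the dominance lemma R5 listed in §20.3) reads: for a simple CM abelian variety `B`
with `T = End⁰(B)` and a smooth projective `S`, the evaluation map
`ev : H¹(B) ⊗_T M(S) → H¹(S)`, `v ⊗ φ ↦ φ(v)`, `M(S) := Hom_HS(H¹(B), H¹(S))`, is injective with image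
the `B`-isotypic part `H¹(S)_B` (the sum of all sub-Hodge structures isomorphic to `H¹(B)`), and for
every morphism of Hodge structures `u : H¹(S) → H¹(S″)` one has `u(H¹(S)_B) ⊂ H¹(S″)_B` and
`u` is `T`-linear on the isotypic parts (`u(t·y) = t·u(y)`).

This file proves the module-theoretic content of that paragraph, for an arbitrary ring `R`, a
SIMPLE `R`-module `X` (= `H¹(B)` as a module over the Mumford–Tate / Hodge algebra; `T = End_R X`
is a division ring by Schur) and arbitrary `R`-modules `Y`, `Y′` (= `H¹(S)`, `H¹(S″)`):

* `EndIndependent φ` — a family `φ : ι → (X →ₗ[R] Y)` is linearly independent over `End R X`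
  acting by precomposition (the `T`-vector-space structure of `M(S)`).
* `lsum_injective_of_endIndependent` — for such a family the evaluation map
  `Finsupp.lsum ℕ φ : (ι →₀ X) →ₗ[R] Y`, `x ↦ ∑ᵢ φᵢ(xᵢ)`, is INJECTIVE (this is the injectivity of
  `ev`: `H¹(B) ⊗_T M(S) ≅ ⊕_{T-basis of M(S)} H¹(B)`).
* `range_lsum_le_isotypicComponent` / `isotypicComponent_eq_iSup_range` — its range lies in the
  `X`-isotypic component of `Y` (Mathlib's `isotypicComponent R Y X`), and that component is exactly
  the sum of the images of ALL `R`-linear maps `X → Y`; with a spanning family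
  (`EndSpanning φ`) the range IS the isotypic component (`range_lsum_eq_isotypicComponent`).
* `comp_lsum_eq` / `lsum_mapRange_smul` / `endIndependent_comp_of_injective` — naturality: a linear
  map `u : Y → Y′` carries the evaluation map of `φ` to that of `u ∘ φ` and commutes with the
  `End R X`-action `x ↦ (t • xᵢ)ᵢ` on `ι →₀ X` (so, through the injective evaluation maps, `u` is
  `T`-linear on the isotypic parts), and `u` injective keeps `φ` independent (the multiplicity of
  `X` in `Y` is non-decreasing along injective maps — ROUTE-C 13.2(a)(i), the Hodge-theoretic half
  of 14.2(c)).

What stays on paper: the dictionary «polarisable ℚ-Hodge structures of weight 1 = semisimple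
modules, Hodge morphisms = module maps» (Poincaré reducibility / Deligne) and the eigenspace
decomposition `H¹(S)_B ⊗ ℂ = ⊕_σ W_σ` of the `T`-action after base change to `ℂ`.

Nothing here says anything about the status of the Hodge conjecture for CM abelian varieties.
-/

set_option autoImplicit false

noncomputable section

namespace Summit.Ventures.HodgeRepro.RouteC.Isotypic

open LinearMap

universe uR uX uY uY' uι

variable {R : Type uR} [Ring R]
variable {X : Type uX} [AddCommGroup X] [Module R X]
variable {Y : Type uY} [AddCommGroup Y] [Module R Y]
variable {Y' : Type uY'} [AddCommGroup Y'] [Module R Y']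
variable {ι : Type uι}

/-- **`End R X`-linear independence** of a family of `R`-linear maps `φ i : X → Y`: no non-trivial
finite combination `∑ᵢ φ i ∘ e i` with coefficients `e i ∈ End R X` (acting by precomposition —
the right `T`-vector-space structure of `M(S) = Hom(H¹(B), H¹(S))`) vanishes. -/
def EndIndependent (φ : ι → X →ₗ[R] Y) : Prop :=
  ∀ (s : Finset ι) (e : ι → Module.End R X),
    (∑ i ∈ s, (φ i).comp (e i)) = 0 → ∀ i ∈ s, e i = 0

/-- **`End R X`-spanning**: every `R`-linear map `X → Y` is a finite combination `∑ᵢ φ i ∘ e i`. -/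
def EndSpanning (φ : ι → X →ₗ[R] Y) : Prop :=
  ∀ ψ : X →ₗ[R] Y, ∃ (s : Finset ι) (e : ι → Module.End R X), ψ = ∑ i ∈ s, (φ i).comp (e i)

/-- In a simple module, a linear map vanishing on one non-zero vector vanishes identically
(every vector is a multiple of that one). -/
theorem eq_zero_of_apply_eq_zero {M N : Type*} [AddCommGroup M] [Module R M] [IsSimpleModule R M]
    [AddCommGroup N] [Module R N] (f : M →ₗ[R] N) {w : M} (hw : w ≠ 0) (h : f w = 0) : f = 0 := by
  ext z
  obtain ⟨r, rfl⟩ := IsSimpleModule.toSpanSingleton_surjective R hw z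
  simp [LinearMap.toSpanSingleton_apply, h]

section Simple

variable [IsSimpleModule R X]

/-- **R5 13.2(a), injectivity of `ev`.** If `X` is simple and `φ : ι → (X →ₗ[R] Y)` is
`End R X`-linearly independent, the evaluation map `(ι →₀ X) →ₗ[R] Y`, `x ↦ ∑ᵢ φ i (x i)`, is
injective: the sum `∑ᵢ φ i (X)` of the images is DIRECT, i.e. `H¹(B) ⊗_T M(S) → H¹(S)` is injective.
Proof: the kernel is a submodule of the semisimple module `ι →₀ X`; if non-zero it contains a simple
submodule `m`, and every coordinate projection `m → X` is zero or an isomorphism (Schur); composing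
with the inverse of a non-zero one produces a non-trivial `End R X`-relation among the `φ i`. -/
theorem lsum_injective_of_endIndependent {φ : ι → X →ₗ[R] Y} (hφ : EndIndependent φ) :
    Function.Injective (Finsupp.lsum ℕ φ) := by
  classical
  rw [← LinearMap.ker_eq_bot]
  by_contra hker
  obtain ⟨m, hmN, hm⟩ :=
    (IsSemisimpleModule.eq_bot_or_exists_simple_le (LinearMap.ker (Finsupp.lsum ℕ φ))).resolve_left
      hker
  haveI : IsSimpleModule R m := hm
  haveI : Nontrivial m := IsSimpleModule.nontrivial R m
  obtain ⟨w, hw⟩ := exists_ne (0 : m)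
  -- the coordinate projections of `m`
  let p : ι → (m →ₗ[R] X) := fun i => (Finsupp.lapply i) ∘ₗ m.subtype
  have hp_apply : ∀ (i : ι) (z : m), p i z = (z : ι →₀ X) i := fun i z => rfl
  -- outside the support of `w` every projection vanishes
  have hp0 : ∀ i, (w : ι →₀ X) i = 0 → p i = 0 := by
    intro i hi
    exact eq_zero_of_apply_eq_zero (p i) hw (by rw [hp_apply, hi])
  -- some coordinate of `w` is non-zero
  have hwne : (w : ι →₀ X) ≠ 0 := fun h => hw (Subtype.ext h)
  obtain ⟨j, hj⟩ : ∃ j, (w : ι →₀ X) j ≠ 0 := by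
    by_contra h
    exact hwne (Finsupp.ext fun j => by_contra fun hj => h ⟨j, hj⟩)
  have hpj : p j ≠ 0 := fun h => hj (by rw [← hp_apply, h, LinearMap.zero_apply])
  -- Schur: `p j : m → X` is an isomorphism
  let ψ : m ≃ₗ[R] X := LinearEquiv.ofBijective (p j) (LinearMap.bijective_of_ne_zero hpj)
  have hψ : ∀ z, ψ z = p j z := fun z => rfl
  -- the relation `∑ᵢ φ i ∘ (p i ∘ ψ⁻¹) = 0` over the support of `w`
  let e : ι → Module.End R X := fun i => (p i) ∘ₗ ψ.symm.toLinearMap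
  have hrel : (∑ i ∈ (w : ι →₀ X).support, (φ i).comp (e i)) = 0 := by
    ext x
    rw [LinearMap.sum_apply, LinearMap.zero_apply]
    -- the vector `v := ψ⁻¹ x ∈ m ≤ ker`
    set v : ι →₀ X := (ψ.symm x).1 with hv
    have hvker : v ∈ LinearMap.ker (Finsupp.lsum ℕ φ) := hmN (ψ.symm x).2
    rw [LinearMap.mem_ker, Finsupp.lsum_apply] at hvker
    have hsupp : v.support ⊆ (w : ι →₀ X).support := by
      intro i hi
      by_contra hi'
      have hvi : v i = 0 := by
        have := hp0 i (Finsupp.notMem_support_iff.mp hi')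
        rw [hv, ← hp_apply, this, LinearMap.zero_apply]
      exact (Finsupp.mem_support_iff.mp hi) hvi
    rw [Finsupp.sum_of_support_subset v hsupp (fun b => φ b) (fun i _ => (φ i).map_zero)] at hvker
    refine Eq.trans ?_ hvker
    refine Finset.sum_congr rfl fun i _ => ?_
    simp only [e, LinearMap.comp_apply, LinearEquiv.coe_coe, hp_apply, hv]
  have hej : e j = 0 := hφ _ e hrel j (Finsupp.mem_support_iff.mpr hj)
  -- but `e j = p j ∘ ψ⁻¹ = id ≠ 0`
  have hid : e j = LinearMap.id := by
    ext x
    simp only [e, LinearMap.comp_apply, LinearEquiv.coe_coe, LinearMap.id_apply]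
    rw [← hψ, LinearEquiv.apply_symm_apply]
  haveI : Nontrivial X := IsSimpleModule.nontrivial R X
  obtain ⟨x, hx⟩ := exists_ne (0 : X)
  have : (e j) x = x := by rw [hid]; rfl
  rw [hej, LinearMap.zero_apply] at this
  exact hx this.symm

/-- The image of a simple module under a linear map lies in its isotypic component. -/
theorem range_le_isotypicComponent (ψ : X →ₗ[R] Y) :
    LinearMap.range ψ ≤ isotypicComponent R Y X := by
  rcases ψ.injective_or_eq_zero with hinj | hzero
  · exact le_sSup ⟨(LinearEquiv.ofInjective ψ hinj).symm⟩
  · rw [hzero, LinearMap.range_zero]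
    exact bot_le

/-- The range of the evaluation map of ANY family `φ` lies in the `X`-isotypic component of `Y`. -/
theorem range_lsum_le_isotypicComponent (φ : ι → X →ₗ[R] Y) :
    LinearMap.range (Finsupp.lsum ℕ φ) ≤ isotypicComponent R Y X := by
  rintro y ⟨x, rfl⟩
  rw [Finsupp.lsum_apply]
  refine Submodule.sum_mem _ fun i _ => ?_
  exact range_le_isotypicComponent (φ i) ⟨x i, rfl⟩

/-- **The isotypic component is the sum of the images of all maps from `X`**
(`H¹(S)_B = ∑_{φ ∈ M(S)} φ(H¹(B))`). -/
theorem isotypicComponent_eq_iSup_range :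
    isotypicComponent R Y X = ⨆ ψ : X →ₗ[R] Y, LinearMap.range ψ := by
  apply le_antisymm
  · refine sSup_le fun m ⟨e⟩ => ?_
    refine le_trans ?_ (le_iSup (fun ψ : X →ₗ[R] Y => LinearMap.range ψ) (m.subtype ∘ₗ e.symm.toLinearMap))
    intro y hy
    exact ⟨e ⟨y, hy⟩, by simp⟩
  · exact iSup_le fun ψ => range_le_isotypicComponent ψ

/-- With an `End R X`-spanning family `φ` the range of the evaluation map IS the isotypic
component: `ev : H¹(B) ⊗_T M(S) → H¹(S)_B` is onto. -/
theorem range_lsum_eq_isotypicComponent {φ : ι → X →ₗ[R] Y} (hφ : EndSpanning φ) :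
    LinearMap.range (Finsupp.lsum ℕ φ) = isotypicComponent R Y X := by
  classical
  refine le_antisymm (range_lsum_le_isotypicComponent φ) ?_
  rw [isotypicComponent_eq_iSup_range]
  refine iSup_le fun ψ => ?_
  obtain ⟨s, e, rfl⟩ := hφ ψ
  rintro y ⟨x, rfl⟩
  rw [LinearMap.sum_apply]
  refine Submodule.sum_mem _ fun i _ => ?_
  exact ⟨Finsupp.single i (e i x), by rw [Finsupp.lsum_single]; rfl⟩

end Simple

section Naturality

/-- **Naturality of `ev` (13.2(a)): `u ∘ ev_φ = ev_{u ∘ φ}`.** A linear map `u : Y → Y′` carries the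
evaluation map of `φ` to the evaluation map of the composed family `u ∘ φ i` — the image of the
isotypic part under `u` is computed by the same formula, so `u(H¹(S)_B) ⊂ H¹(S″)_B`. -/
theorem comp_lsum_eq (u : Y →ₗ[R] Y') (φ : ι → X →ₗ[R] Y) :
    u ∘ₗ Finsupp.lsum ℕ φ = Finsupp.lsum ℕ (fun i => u ∘ₗ φ i) := by
  ext i x
  simp

/-- **`T`-equivariance of `ev` (13.2(a)): `ev_φ (t • x) = ev_{φ ∘ t} (x)`.** The action of
`t ∈ End R X` on `ι →₀ X` (coordinate-wise) corresponds under evaluation to precomposition of the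
family with `t` — the `T`-action on the isotypic part `H¹(S)_B` is `t · φ(v) = φ(t v)`, and
composing with `comp_lsum_eq` shows `u(t · y) = t · u(y)` for every linear `u`. -/
theorem lsum_mapRange_smul (φ : ι → X →ₗ[R] Y) (t : Module.End R X) (x : ι →₀ X) :
    Finsupp.lsum ℕ φ (Finsupp.mapRange (fun v => t v) (map_zero t) x) =
      Finsupp.lsum ℕ (fun i => φ i ∘ₗ t) x := by
  classical
  simp only [Finsupp.lsum_apply]
  rw [Finsupp.sum_mapRange_index (fun i => (φ i).map_zero)]
  rfl

/-- **Multiplicities are non-decreasing along injective maps (13.2(a)(i), 14.2(c)).** If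
`u : Y → Y′` is injective and `φ` is `End R X`-independent, so is `u ∘ φ`: the `T`-dimension of
`M(S) = Hom(H¹(B), H¹(S))` does not drop along the pull-back `π^* : H¹(S_Γ) ↪ H¹(S_{Γ′})` of a
finite cover. -/
theorem endIndependent_comp_of_injective {u : Y →ₗ[R] Y'} (hu : Function.Injective u)
    {φ : ι → X →ₗ[R] Y} (hφ : EndIndependent φ) : EndIndependent (fun i => u ∘ₗ φ i) := by
  intro s e h
  refine hφ s e (LinearMap.ext fun x => hu ?_)
  have hx := LinearMap.congr_fun h x
  simp only [LinearMap.sum_apply, LinearMap.comp_apply, LinearMap.zero_apply] at hx ⊢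
  rw [map_sum, map_zero]
  exact hx

end Naturality

section Basis

/-- **Precomposition: `Hom_R(X, Y)` as a module over the opposite ring of `End R X`** — the right
`T`-vector-space structure of `M(S) = Hom(H¹(B), H¹(S))`, `(op t) • φ = φ ∘ t`. A plain definition (never
a global instance, so that it does not compete with `Semiring.toOppositeModule` on `End R X` when
`Y = X`); the theorems below take ANY module structure with this `smul` law as a hypothesis and the
existence theorem instantiates this one term-level. -/
abbrev endMopModule : Module (Module.End R X)ᵐᵒᵖ (X →ₗ[R] Y) where
  smul d φ := φ ∘ₗ d.unop
  one_smul φ := LinearMap.ext fun _ => rfl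
  mul_smul d d' φ := LinearMap.ext fun _ => rfl
  smul_zero d := LinearMap.ext fun _ => rfl
  smul_add d φ ψ := LinearMap.ext fun _ => rfl
  add_smul d d' φ := LinearMap.ext fun x => by
    change φ (d.unop x + d'.unop x) = φ (d.unop x) + φ (d'.unop x)
    exact map_add φ _ _
  zero_smul φ := LinearMap.ext fun _ => map_zero φ

/-- The `smul` law of `endMopModule`: `op t • φ = φ ∘ t`. -/
theorem endMopModule_smul_def (d : (Module.End R X)ᵐᵒᵖ) (φ : X →ₗ[R] Y) :
    @HSMul.hSMul _ _ _ (@instHSMul _ _ (endMopModule (R := R) (X := X) (Y := Y)).toSMul) d φ =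
      φ ∘ₗ d.unop := rfl

variable [inst : Module (Module.End R X)ᵐᵒᵖ (X →ₗ[R] Y)]
  (hinst : ∀ (d : (Module.End R X)ᵐᵒᵖ) (φ : X →ₗ[R] Y), d • φ = φ ∘ₗ d.unop)

include hinst in
/-- Linear independence over `(End R X)ᵐᵒᵖ` (Mathlib's notion, for any module structure with the
precomposition law) is `EndIndependent`. -/
theorem endIndependent_of_linearIndependent {φ : ι → X →ₗ[R] Y}
    (h : LinearIndependent (Module.End R X)ᵐᵒᵖ φ) : EndIndependent φ := by
  intro s e he
  have key := linearIndependent_iff'.mp h s (fun i => MulOpposite.op (e i)) (by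
    rw [← he]
    exact Finset.sum_congr rfl fun i _ => hinst _ _)
  intro i hi
  exact (MulOpposite.op_eq_zero_iff (e i)).mp (key i hi)

include hinst in
/-- Spanning over `(End R X)ᵐᵒᵖ` (Mathlib's `Submodule.span`, same module structure) is `EndSpanning`. -/
theorem endSpanning_of_span_eq_top {φ : ι → X →ₗ[R] Y}
    (h : Submodule.span (Module.End R X)ᵐᵒᵖ (Set.range φ) = ⊤) : EndSpanning φ := by
  intro ψ
  have hψ : ψ ∈ Submodule.span (Module.End R X)ᵐᵒᵖ (Set.range φ) := h ▸ Submodule.mem_top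
  obtain ⟨c, hc⟩ := Finsupp.mem_span_range_iff_exists_finsupp.mp hψ
  refine ⟨c.support, fun i => (c i).unop, ?_⟩
  rw [← hc, Finsupp.sum]
  exact Finset.sum_congr rfl fun i _ => hinst _ _

include hinst in
/-- A `(End R X)ᵐᵒᵖ`-basis of `Hom_R(X, Y)` is an `EndIndependent` and `EndSpanning` family. -/
theorem basis_endIndependent_endSpanning (b : Module.Basis ι (Module.End R X)ᵐᵒᵖ (X →ₗ[R] Y)) :
    EndIndependent b ∧ EndSpanning b :=
  ⟨endIndependent_of_linearIndependent hinst b.linearIndependent,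
    endSpanning_of_span_eq_top hinst b.span_eq⟩

omit inst hinst in
/-- **A `T`-basis of `M(S)` exists** (Schur: `End R X` is a division ring for simple `X`, so
`Hom_R(X, Y)` is a vector space over its opposite, with the precomposition structure `endMopModule`):
there is a family `φ : ι → (X →ₗ[R] Y)` that is `EndIndependent` and `EndSpanning`. -/
theorem exists_endIndependent_endSpanning [IsSimpleModule R X] :
    ∃ (ι : Type (max uX uY)) (φ : ι → X →ₗ[R] Y), EndIndependent φ ∧ EndSpanning φ := by
  classical
  letI : Module (Module.End R X)ᵐᵒᵖ (X →ₗ[R] Y) := endMopModule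
  exact ⟨_, _, basis_endIndependent_endSpanning (fun _ _ => rfl)
    (Module.Basis.ofVectorSpace (Module.End R X)ᵐᵒᵖ (X →ₗ[R] Y))⟩

end Basis

section IsotypicEquiv

variable [IsSimpleModule R X]

/-- **13.2(a), the isotypic isomorphism:** for an `EndIndependent` + `EndSpanning` family
(a `T`-basis of `M(S)` indexed by `ι`) the evaluation map is an `R`-linear isomorphism
`ι →₀ X ≃ isotypicComponent R Y X` — `H¹(S)_B ≅ H¹(B)^{(ι)} = H¹(B) ⊗_T M(S)`, the multiplicity of
`B` in `Alb S` being `dim_T M(S) = |ι|`. -/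
def isotypicEquiv {φ : ι → X →ₗ[R] Y} (h1 : EndIndependent φ) (h2 : EndSpanning φ) :
    (ι →₀ X) ≃ₗ[R] isotypicComponent R Y X :=
  (LinearEquiv.ofInjective (Finsupp.lsum ℕ φ) (lsum_injective_of_endIndependent h1)).trans
    (LinearEquiv.ofEq _ _ (range_lsum_eq_isotypicComponent h2))

/-- The isotypic isomorphism is the evaluation map. -/
theorem isotypicEquiv_apply {φ : ι → X →ₗ[R] Y} (h1 : EndIndependent φ) (h2 : EndSpanning φ)
    (x : ι →₀ X) : (isotypicEquiv h1 h2 x : Y) = Finsupp.lsum ℕ φ x := rfl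

/-- **The isotypic component is a direct sum of copies of `X`** (Mathlib-style corollary:
`H¹(S)_B ≅ ⊕_ι H¹(B)` for some index set `ι`). -/
theorem exists_linearEquiv_isotypicComponent :
    ∃ ι : Type (max uX uY), Nonempty ((ι →₀ X) ≃ₗ[R] isotypicComponent R Y X) :=
  have ⟨ι, _, h1, h2⟩ := exists_endIndependent_endSpanning (R := R) (X := X) (Y := Y)
  ⟨ι, ⟨isotypicEquiv h1 h2⟩⟩

end IsotypicEquiv

end Summit.Ventures.HodgeRepro.RouteC.Isotypic
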